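/-
Copyright (c) 2026 the pub-hodgecm-mathlib formalisation cell (harness21).  Prover seats hodgecm-mathlib-LA3-p01 (g0) (★ (ν8R) original) and A-p06 (g36) (the (v-c) FACTORISATION row, L2 organ (IMG)), P6 «MOD programme»,
organ **(ν8R)+(v-c)** = ★ (ν8) `exists_specialFibre_hom_reduction` WITH THE KERNEL READINGS (v-b) KILL ∕ (v-a) CLAUSE ALONG THE VALUATION-RING MODEL (LA3-plan 2026-09-02 04:00:01Z); 2026-09-02.
-/
import Literature.AlgebraicGeometry.AbelianSchemes.AbelianSchemeHomReductionValuationModel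
import Literature.AlgebraicGeometry.AbelianSchemes.AbelianSchemeFibreAlongIntegralPoint
import Literature.AlgebraicGeometry.AbelianSchemes.IsogenyKernelReduction
import Literature.AlgebraicGeometry.Limits.SeparatedSchematicExt
import Literature.AlgebraicGeometry.AbelianSchemes.AbelianSchemeHomFactorisationValuationModel
import HarnessLib

/-!
# REDUCTION OF A HOMOMORPHISM BETWEEN FIBRE TUPLES — THE SPECIAL-FIBRE OUTPUT WITH KERNEL READINGS AND THE FACTORISATION ROW (v-c) ALONG THE VALUATION-RING MODEL

IMAGE EDITION (A-p06 (g36), L2 organ (IMG), LA2-plan (g2) ruling 2026-09-02T08:56Z «(IMG-T) (c)»): this file is ★ `AbelianSchemeHomReductionSpecialFibreModel` BY COPY with ONE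
more conjunct **(v-c) FACTORISATION** for the SAME `ū`: for a flat `incl : 𝒦 → 𝒜_x̃` and a CLOSED `ζ : 𝒵 ↪ 𝒞_x̃″` (`x̃″` the `R`-point extending `x″`), if `𝒦_η`, read in
`(𝒜_η)_x` through the three-piece isomorphism, is carried by `u` INTO `𝒵_η` read in `(𝒞_η)_{x″}`, then `𝒦_s̄` is carried by `ū` into `𝒵_s̄` (★ p850724
`pullback_map_exists_comp_specialFibre_of_generic` at the turnkey's stage; the `𝒞`-side model base `x̃″` factors through the stage by the turnkey's `hz″`).  Head renamed
`exists_specialFibre_hom_reduction_model_image`; everything else token-identical.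
# ([SerreTate1968] §1 Lemma 2: a flat subgroup of the model that `u` kills upstairs is killed by `ū` downstairs; [BoschLutkebohmertRaynaud1990] §7.1)

Topic `AlgebraicGeometry/AbelianSchemes`, namespace `Literature.AlgebraicGeometry.AbelianSchemes.AbelianSchemeOver`.  THEOREMS ONLY (no definition, no named fact, no
instance, no notation).  Cell `hodgecm-mathlib` (D-0151), F0∕P6 «MOD», organ **(ν8R)**: the head of ★ (ν8) `exists_specialFibre_hom_reduction` VERBATIM ((i)–(iv)) PLUS two
kernel readings of `ū` along the `R`-MODEL of the point — `R := 𝒪_Ω̄ =` ★ `closureValuationSubring`, `x̃ :=` ★ `extendPoint R (toClosureValuationSubring v) 𝓨.total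
(𝓨.modelPointsEquiv.symm x)` the `R`-point extending `x` (valuative criterion), `𝒜_x̃ := 𝒜.baseChange x̃.left`, generic point `η_R :=` ★ `(specFractionFieldι R _).left`, geometric closed
point `s̄_R := c⁻¹ ≫ Spec (residue R)`; sub-objects `incl : 𝒦 → 𝒜_x̃` with `𝒦 → Spec R` FLAT are read upstairs in `(𝒜_η)_x` and downstairs in `(𝒜_s)_x̄` through the EXPLICIT three-piece
isomorphisms of ★ (d5) `AbelianSchemeFibreAlongIntegralPoint` (`fibreBaseChangeIso ≪≫ fibreCongrPtIso (point equality) ≪≫ fibreBaseChangeIso⁻¹`): (v-b) KILL — `𝒦_η` killed by `u`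
⇒ `𝒦_s̄` killed by `ū`; (v-a) CLAUSE — for `u` finite surjective and `incl` a closed immersion, `𝒦_η = Ker u` on `T`-points ⇒ `𝒦_s̄ = Ker ū` on `T`-points.
PROOF: ★ (ν7) turnkey (stage `Spec D′`, `x̃ = Spec h′ ≫ Spec(D → D′) ≫ z`), ★ (ν8R) abstract `specialFibre_transfers_of_generic_model` (six transfers in one application), `Ker U`
flat by ★ `flat_ker_hom` (every fibre of `U` an isogeny).  Consumers: L2's `spGeoOf` kernel-reading law (`𝒦 :=` the closure of a line in the (S-c) layer of `𝒜_x̃`) and L3's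
`stub_ROOFGEO`; apply ★ (v-gen)∕p848647 downstream for further base changes.

HONEST LABEL: HC_CM is proved only modulo the cell's 2 remaining named inputs (hLiu418 24832, h413 24833) until rung 0 closes; generic capital on
`--supports stmt-HodgeConjecture-24832`, pays no letter.

## References
* [SerreTate1968] J.-P. Serre, J. Tate, *Good reduction of abelian varieties*, Ann. of Math. 88 (1968), §1 (Lemma 2, Theorem 1).
* [BoschLutkebohmertRaynaud1990] S. Bosch, W. Lütkebohmert, M. Raynaud, *Néron Models* (1990), §1.2 Prop. 8, §7.1 Prop. 6, §7.3 Prop. 6 (p. 180).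
* [MumfordFogartyKirwan1994] D. Mumford, J. Fogarty, F. Kirwan, *GIT*, 3rd ed., Ch. 6 §1 Cor. 6.2 (p. 116), Ch. 7 §2 Def. 7.1–7.2 (p. 129).
* [MumfordAV1970] D. Mumford, *Abelian Varieties* (1970), §15 Thm. 1 (p. 143).
* [Hartshorne1977] R. Hartshorne, *Algebraic Geometry*, II.4.7 (valuative criterion).
-/

set_option autoImplicit false

noncomputable section

set_option backward.isDefEq.respectTransparency false

open CategoryTheory CategoryTheory.Limits AlgebraicGeometry
open scoped MonObj CategoryTheory.Obj NumberField
open Literature.AlgebraicGeometry.Motives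
open IsDedekindDomain IsDedekindDomain.HeightOneSpectrum ValuativeRel
open Literature.NumberTheory.EllipticCurves (genericFibre specGenericPoint)
open Literature.NumberTheory.GaloisRepresentations (closureValuationSubring)
open Literature.NumberTheory.DiophantineGeometry
open Literature.AlgebraicGeometry.GroupSchemes.GroupSchemeKernel (ker)

namespace Literature.AlgebraicGeometry.AbelianSchemes

namespace AbelianSchemeOver

universe u

section Head

variable {K : Type} [Field K] [NumberField K] {v : HeightOneSpectrum (𝓞 K)} {Y : SchemeOver K}
  (𝓨 : IntegralModel (valuationSubringAtPrime K v) K Y) [IsProper 𝓨.total.hom]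
  (𝒜 𝒞 : AbelianSchemeOver 𝓨.total.left) (x x'' : AlgPoints Y (AlgebraicClosure (v.adicCompletion K)))

set_option maxHeartbeats 800000 in
set_option synthInstance.maxHeartbeats 200000 in
/-- **THE SPECIAL FIBRE OF THE REDUCTION OF A HOMOMORPHISM BETWEEN FIBRE TUPLES, WITH ITS FOUR TRANSFERS AND ITS KERNEL READINGS ALONG THE VALUATION-RING MODEL.**
★ (ν8) `exists_specialFibre_hom_reduction` verbatim ((i) finite surjective ⇒ flat surjective, (ii) equivariance, (iii) section values, (iv) polarisation laws) PLUS, with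
`R := 𝒪_Ω̄`, `x̃` the `R`-point of `𝓨` extending `x`, `𝒜_x̃ := 𝒜 ×_𝓨 Spec R`, and any `incl : 𝒦 → 𝒜_x̃` with `𝒦 → Spec R` flat, read in `(𝒜_η)_x` ∕ `(𝒜_s)_x̄` through the
three-piece isomorphisms `(𝒜_η)_x ≅ 𝒜_(x ≫ ι_η) = 𝒜_(η_R ≫ x̃) ≅ (𝒜_x̃)_(η_R)` and `(𝒜_s)_x̄ ≅ 𝒜_(x̄ ≫ ι_s) = 𝒜_(s̄_R ≫ x̃) ≅ (𝒜_x̃)_(s̄_R)` (★ (d5)): (v-b) if `u` kills `𝒦_(η_R)` then `ū`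
kills `𝒦_(s̄_R)`; (v-a) if moreover `incl` is a closed immersion, `u` is finite surjective and `𝒦_(η_R)` carries the kernel clause of `u` on all `T`-points, then `𝒦_(s̄_R)`
carries the kernel clause of `ū` on all `T`-points. [cite: SerreTate1968, §1 Lemma 2 and Theorem 1] [cite: BoschLutkebohmertRaynaud1990, §1.2 Prop. 8, §7.1 Prop. 6 and §7.3 Prop. 6 (p. 180)]
[cite: MumfordFogartyKirwan1994, Ch. 6 §1 Corollary 6.2 (p. 116); Ch. 7 §2 Definition 7.2 (p. 129)] [cite: MumfordAV1970, §15 Thm. 1 (p. 143)] [cite: Hartshorne1977, II.4.7] -/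
theorem exists_specialFibre_hom_reduction_model_image
    (u : ((𝒜.baseChange (𝓨.genericIso'.inv.left ≫ pullback.fst 𝓨.total.hom (specGenericPoint (valuationSubringAtPrime K v) K))).baseChange x.left).X ⟶
         ((𝒞.baseChange (𝓨.genericIso'.inv.left ≫ pullback.fst 𝓨.total.hom (specGenericPoint (valuationSubringAtPrime K v) K))).baseChange x''.left).X)
    [IsMonHom u] :
    ∃ (ubar : ((𝒜.baseChange (pullback.fst 𝓨.total.hom (specResidueField v))).baseChange (𝓨.geomReductionMap x).left).X ⟶
               ((𝒞.baseChange (pullback.fst 𝓨.total.hom (specResidueField v))).baseChange (𝓨.geomReductionMap x'').left).X) (_ : IsMonHom ubar),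
      -- (i) finite surjective ⇒ flat surjective
      (IsFinite u.left → Surjective u.left → Flat ubar.left ∧ Function.Surjective ubar.left.base) ∧
      -- (ii) equivariance for endomorphism pairs transfers
      (∀ (f : 𝒜.X ⟶ 𝒜.X) (g : 𝒞.X ⟶ 𝒞.X) [IsMonHom f] [IsMonHom g],
        baseChangeHom (baseChangeHom f _) x.left ≫ u = u ≫ baseChangeHom (baseChangeHom g _) x''.left →
        baseChangeHom (baseChangeHom f (pullback.fst 𝓨.total.hom (specResidueField v))) (𝓨.geomReductionMap x).left ≫ ubar =
          ubar ≫ baseChangeHom (baseChangeHom g (pullback.fst 𝓨.total.hom (specResidueField v))) (𝓨.geomReductionMap x'').left) ∧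
      -- (iii) identities of section values transfer
      (∀ (τ : 𝒜.Sections) (τ'' : 𝒞.Sections),
        AlgPoints.map u ((𝒜.baseChange _).restrictPt x.left (𝒜.sectionBaseChange _ τ)) =
          (𝒞.baseChange _).restrictPt x''.left (𝒞.sectionBaseChange _ τ'') →
        AlgPoints.map ubar ((𝒜.baseChange (pullback.fst 𝓨.total.hom (specResidueField v))).restrictPt (𝓨.geomReductionMap x).left
            (𝒜.sectionBaseChange _ τ)) =
          (𝒞.baseChange (pullback.fst 𝓨.total.hom (specResidueField v))).restrictPt (𝓨.geomReductionMap x'').left (𝒞.sectionBaseChange _ τ'')) ∧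
      -- (iv) a polarisation law in dual-homomorphism form transfers
      (∀ (D𝒜 : 𝒜.DualPair) (pol𝒜 : 𝒜.Polarization D𝒜) (D𝒞 : 𝒞.DualPair) (pol𝒞 : 𝒞.Polarization D𝒞) (n : ℕ),
        u ≫ ((pol𝒞.baseChange _).baseChange x''.left).lam ≫ DualPair.dualIsogenyOver u ((D𝒜.baseChange _).baseChange x.left) ((D𝒞.baseChange _).baseChange x''.left) =
          ((pol𝒜.baseChange _).baseChange x.left).lam ≫ ((D𝒜.baseChange _).baseChange x.left).hat.mulN n →
        ubar ≫ ((pol𝒞.baseChange (pullback.fst 𝓨.total.hom (specResidueField v))).baseChange (𝓨.geomReductionMap x'').left).lam ≫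
            DualPair.dualIsogenyOver ubar ((D𝒜.baseChange (pullback.fst 𝓨.total.hom (specResidueField v))).baseChange (𝓨.geomReductionMap x).left)
              ((D𝒞.baseChange (pullback.fst 𝓨.total.hom (specResidueField v))).baseChange (𝓨.geomReductionMap x'').left) =
          ((pol𝒜.baseChange (pullback.fst 𝓨.total.hom (specResidueField v))).baseChange (𝓨.geomReductionMap x).left).lam ≫
            ((D𝒜.baseChange (pullback.fst 𝓨.total.hom (specResidueField v))).baseChange (𝓨.geomReductionMap x).left).hat.mulN n) ∧
      -- (v-b) KILL along a flat `𝒦 ↪ 𝒜_x̃` over the valuation ring `R = 𝒪_Ω̄` of the point (`x̃` the `R`-point extending `x`): if `𝒦_η`, read in `(𝒜_η)_x` through the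
      -- three-piece isomorphism of ★ (d5), is killed by `u`, then `𝒦_s`, read in `(𝒜_s)_x̄`, is killed by `ū`
      (∀ (𝒦 : Over (Spec (.of (closureValuationSubring (v.adicCompletion K))))) (incl : 𝒦 ⟶ (𝒜.baseChange (extendPoint (closureValuationSubring (v.adicCompletion K)) (toClosureValuationSubring v) 𝓨.total (𝓨.modelPointsEquiv.symm x)).left).X) [Flat 𝒦.hom],
        ((Over.pullback (specFractionFieldι (closureValuationSubring (v.adicCompletion K)) (toClosureValuationSubring v)).left).map incl ≫
            (𝒜.fibreBaseChangeIso (𝓨.genericIso'.inv.left ≫ pullback.fst 𝓨.total.hom (specGenericPoint (valuationSubringAtPrime K v) K)) x.left ≪≫ 𝒜.fibreCongrPtIso (𝓨.left_specFractionFieldι_comp_extendPoint_modelPointsEquiv_symm x).symm ≪≫ (𝒜.fibreBaseChangeIso (extendPoint (closureValuationSubring (v.adicCompletion K)) (toClosureValuationSubring v) 𝓨.total (𝓨.modelPointsEquiv.symm x)).left (specFractionFieldι (closureValuationSubring (v.adicCompletion K)) (toClosureValuationSubring v)).left).symm).inv.hom.hom.hom) ≫ u = 1 →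
        ((Over.pullback ((geomClosedPointIsoSpecResidueField v).inv.left ≫ (specRingHomι (closureValuationSubring (v.adicCompletion K)) (toClosureValuationSubring v) (IsLocalRing.residue (closureValuationSubring (v.adicCompletion K)))).left)).map incl ≫
            (𝒜.fibreBaseChangeIso (pullback.fst 𝓨.total.hom (specResidueField v)) (𝓨.geomReductionMap x).left ≪≫ 𝒜.fibreCongrPtIso ((𝓨.left_geomReductionMap_comp_fst x).trans (Category.assoc _ _ _).symm) ≪≫ (𝒜.fibreBaseChangeIso (extendPoint (closureValuationSubring (v.adicCompletion K)) (toClosureValuationSubring v) 𝓨.total (𝓨.modelPointsEquiv.symm x)).left ((geomClosedPointIsoSpecResidueField v).inv.left ≫ (specRingHomι (closureValuationSubring (v.adicCompletion K)) (toClosureValuationSubring v) (IsLocalRing.residue (closureValuationSubring (v.adicCompletion K)))).left)).symm).inv.hom.hom.hom) ≫ ubar = 1) ∧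
      -- (v-a) the kernel CLAUSE along a flat closed `𝒦 ↪ 𝒜_x̃`, for `u` finite surjective: `𝒦_η = Ker u` on `T`-points ⇒ `𝒦_s = Ker ū` on `T`-points
      (∀ (𝒦 : Over (Spec (.of (closureValuationSubring (v.adicCompletion K))))) (incl : 𝒦 ⟶ (𝒜.baseChange (extendPoint (closureValuationSubring (v.adicCompletion K)) (toClosureValuationSubring v) 𝓨.total (𝓨.modelPointsEquiv.symm x)).left).X) [Flat 𝒦.hom] [IsClosedImmersion incl.left],
        IsFinite u.left → Surjective u.left →
        (∀ ⦃W : Over (Spec (.of (AlgebraicClosure (v.adicCompletion K))))⦄ (t : W ⟶ ((𝒜.baseChange (extendPoint (closureValuationSubring (v.adicCompletion K)) (toClosureValuationSubring v) 𝓨.total (𝓨.modelPointsEquiv.symm x)).left).baseChange (specFractionFieldι (closureValuationSubring (v.adicCompletion K)) (toClosureValuationSubring v)).left).X),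
          (∃ s : W ⟶ (Over.pullback (specFractionFieldι (closureValuationSubring (v.adicCompletion K)) (toClosureValuationSubring v)).left).obj 𝒦, s ≫ (Over.pullback (specFractionFieldι (closureValuationSubring (v.adicCompletion K)) (toClosureValuationSubring v)).left).map incl = t) ↔
            (t ≫ (𝒜.fibreBaseChangeIso (𝓨.genericIso'.inv.left ≫ pullback.fst 𝓨.total.hom (specGenericPoint (valuationSubringAtPrime K v) K)) x.left ≪≫ 𝒜.fibreCongrPtIso (𝓨.left_specFractionFieldι_comp_extendPoint_modelPointsEquiv_symm x).symm ≪≫ (𝒜.fibreBaseChangeIso (extendPoint (closureValuationSubring (v.adicCompletion K)) (toClosureValuationSubring v) 𝓨.total (𝓨.modelPointsEquiv.symm x)).left (specFractionFieldι (closureValuationSubring (v.adicCompletion K)) (toClosureValuationSubring v)).left).symm).inv.hom.hom.hom) ≫ u = 1) →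
        ∀ ⦃W : Over (Spec (.of (geomResidueField v)))⦄ (t : W ⟶ ((𝒜.baseChange (extendPoint (closureValuationSubring (v.adicCompletion K)) (toClosureValuationSubring v) 𝓨.total (𝓨.modelPointsEquiv.symm x)).left).baseChange ((geomClosedPointIsoSpecResidueField v).inv.left ≫ (specRingHomι (closureValuationSubring (v.adicCompletion K)) (toClosureValuationSubring v) (IsLocalRing.residue (closureValuationSubring (v.adicCompletion K)))).left)).X),
          (∃ s : W ⟶ (Over.pullback ((geomClosedPointIsoSpecResidueField v).inv.left ≫ (specRingHomι (closureValuationSubring (v.adicCompletion K)) (toClosureValuationSubring v) (IsLocalRing.residue (closureValuationSubring (v.adicCompletion K)))).left)).obj 𝒦, s ≫ (Over.pullback ((geomClosedPointIsoSpecResidueField v).inv.left ≫ (specRingHomι (closureValuationSubring (v.adicCompletion K)) (toClosureValuationSubring v) (IsLocalRing.residue (closureValuationSubring (v.adicCompletion K)))).left)).map incl = t) ↔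
            (t ≫ (𝒜.fibreBaseChangeIso (pullback.fst 𝓨.total.hom (specResidueField v)) (𝓨.geomReductionMap x).left ≪≫ 𝒜.fibreCongrPtIso ((𝓨.left_geomReductionMap_comp_fst x).trans (Category.assoc _ _ _).symm) ≪≫ (𝒜.fibreBaseChangeIso (extendPoint (closureValuationSubring (v.adicCompletion K)) (toClosureValuationSubring v) 𝓨.total (𝓨.modelPointsEquiv.symm x)).left ((geomClosedPointIsoSpecResidueField v).inv.left ≫ (specRingHomι (closureValuationSubring (v.adicCompletion K)) (toClosureValuationSubring v) (IsLocalRing.residue (closureValuationSubring (v.adicCompletion K)))).left)).symm).inv.hom.hom.hom) ≫ ubar = 1) ∧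
      -- (v-c) FACTORISATION along a flat `𝒦 ↪ 𝒜_x̃` INTO a closed `𝒵 ↪ 𝒞_x̃″` (A-p06 (g36), ★ p850724): `𝒦_η` carried by `u` into `𝒵_η` ⇒ `𝒦_s̄` carried by `ū` into `𝒵_s̄`
      (∀ (𝒦 : Over (Spec (.of (closureValuationSubring (v.adicCompletion K))))) (incl : 𝒦 ⟶ (𝒜.baseChange (extendPoint (closureValuationSubring (v.adicCompletion K)) (toClosureValuationSubring v) 𝓨.total (𝓨.modelPointsEquiv.symm x)).left).X) [Flat 𝒦.hom]
        (𝒵 : Over (Spec (.of (closureValuationSubring (v.adicCompletion K))))) (ζ : 𝒵 ⟶ (𝒞.baseChange (extendPoint (closureValuationSubring (v.adicCompletion K)) (toClosureValuationSubring v) 𝓨.total (𝓨.modelPointsEquiv.symm x'')).left).X) [IsClosedImmersion ζ.left],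
        (∃ m : (Over.pullback (specFractionFieldι (closureValuationSubring (v.adicCompletion K)) (toClosureValuationSubring v)).left).obj 𝒦 ⟶ (Over.pullback (specFractionFieldι (closureValuationSubring (v.adicCompletion K)) (toClosureValuationSubring v)).left).obj 𝒵,
          m ≫ ((Over.pullback (specFractionFieldι (closureValuationSubring (v.adicCompletion K)) (toClosureValuationSubring v)).left).map ζ ≫ (𝒞.fibreBaseChangeIso (𝓨.genericIso'.inv.left ≫ pullback.fst 𝓨.total.hom (specGenericPoint (valuationSubringAtPrime K v) K)) x''.left ≪≫ 𝒞.fibreCongrPtIso (𝓨.left_specFractionFieldι_comp_extendPoint_modelPointsEquiv_symm x'').symm ≪≫ (𝒞.fibreBaseChangeIso (extendPoint (closureValuationSubring (v.adicCompletion K)) (toClosureValuationSubring v) 𝓨.total (𝓨.modelPointsEquiv.symm x'')).left (specFractionFieldι (closureValuationSubring (v.adicCompletion K)) (toClosureValuationSubring v)).left).symm).inv.hom.hom.hom) =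
            ((Over.pullback (specFractionFieldι (closureValuationSubring (v.adicCompletion K)) (toClosureValuationSubring v)).left).map incl ≫ (𝒜.fibreBaseChangeIso (𝓨.genericIso'.inv.left ≫ pullback.fst 𝓨.total.hom (specGenericPoint (valuationSubringAtPrime K v) K)) x.left ≪≫ 𝒜.fibreCongrPtIso (𝓨.left_specFractionFieldι_comp_extendPoint_modelPointsEquiv_symm x).symm ≪≫ (𝒜.fibreBaseChangeIso (extendPoint (closureValuationSubring (v.adicCompletion K)) (toClosureValuationSubring v) 𝓨.total (𝓨.modelPointsEquiv.symm x)).left (specFractionFieldι (closureValuationSubring (v.adicCompletion K)) (toClosureValuationSubring v)).left).symm).inv.hom.hom.hom) ≫ u) →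
        ∃ m : (Over.pullback ((geomClosedPointIsoSpecResidueField v).inv.left ≫ (specRingHomι (closureValuationSubring (v.adicCompletion K)) (toClosureValuationSubring v) (IsLocalRing.residue (closureValuationSubring (v.adicCompletion K)))).left)).obj 𝒦 ⟶ (Over.pullback ((geomClosedPointIsoSpecResidueField v).inv.left ≫ (specRingHomι (closureValuationSubring (v.adicCompletion K)) (toClosureValuationSubring v) (IsLocalRing.residue (closureValuationSubring (v.adicCompletion K)))).left)).obj 𝒵,
          m ≫ ((Over.pullback ((geomClosedPointIsoSpecResidueField v).inv.left ≫ (specRingHomι (closureValuationSubring (v.adicCompletion K)) (toClosureValuationSubring v) (IsLocalRing.residue (closureValuationSubring (v.adicCompletion K)))).left)).map ζ ≫ (𝒞.fibreBaseChangeIso (pullback.fst 𝓨.total.hom (specResidueField v)) (𝓨.geomReductionMap x'').left ≪≫ 𝒞.fibreCongrPtIso ((𝓨.left_geomReductionMap_comp_fst x'').trans (Category.assoc _ _ _).symm) ≪≫ (𝒞.fibreBaseChangeIso (extendPoint (closureValuationSubring (v.adicCompletion K)) (toClosureValuationSubring v) 𝓨.total (𝓨.modelPointsEquiv.symm x'')).left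 ((geomClosedPointIsoSpecResidueField v).inv.left ≫ (specRingHomι (closureValuationSubring (v.adicCompletion K)) (toClosureValuationSubring v) (IsLocalRing.residue (closureValuationSubring (v.adicCompletion K)))).left)).symm).inv.hom.hom.hom) =
            ((Over.pullback ((geomClosedPointIsoSpecResidueField v).inv.left ≫ (specRingHomι (closureValuationSubring (v.adicCompletion K)) (toClosureValuationSubring v) (IsLocalRing.residue (closureValuationSubring (v.adicCompletion K)))).left)).map incl ≫ (𝒜.fibreBaseChangeIso (pullback.fst 𝓨.total.hom (specResidueField v)) (𝓨.geomReductionMap x).left ≪≫ 𝒜.fibreCongrPtIso ((𝓨.left_geomReductionMap_comp_fst x).trans (Category.assoc _ _ _).symm) ≪≫ (𝒜.fibreBaseChangeIso (extendPoint (closureValuationSubring (v.adicCompletion K)) (toClosureValuationSubring v) 𝓨.total (𝓨.modelPointsEquiv.symm x)).left ((geomClosedPointIsoSpecResidueField v).inv.left ≫ (specRingHomι (closureValuationSubring (v.adicCompletion K)) (toClosureValuationSubring v) (IsLocalRing.residue (closureValuationSubring (v.adicCompletion K)))).left)).symm).inv.hom.hom.hom) ≫ ubar) := by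
  -- the homomorphism of abelian varieties underlying `u`, and the TURNKEY reduction ★ (ν7)
  obtain ⟨D, _i1, _i2, L, _i3, _i4, _i5, _i6, _i7, _i8, gD, h, hh, hgD, ha, z, z'', hz, hz'', L', _j1, _j2, _j3, _j4, _j5, χ, h', U, hU,
      hpt, hpt'', e, hspt, hspt'', et, hχ, hh', hh'h, hDed, hFrac, hfib, huniq, hisog⟩ :=
    exists_stage_hom_reduction_turnkey 𝓨 𝒜 𝒞 x x'' (homOfIsMonHom u)
  haveI := hDed
  haveI := hFrac
  haveI := hU
  -- injectivity of restriction to the `Ω`-point `ξ′` of the refined stage (schematically dominant: `D′ → Ω` injective)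
  have h'inj : Function.Injective h' := by
    intro a b hab
    have h1 : χ (a : L') = χ (b : L') := by rw [← hh', ← hh', hab]
    exact Subtype.ext (hχ h1)
  haveI : IsDominant (specGenericPoint (closureValuationSubring (v.adicCompletion K)) (AlgebraicClosure (v.adicCompletion K)) ≫ Spec.map (CommRingCat.ofHom h')) := by
    haveI := isDominant_specMap_of_injective
      (algebraMap (closureValuationSubring (v.adicCompletion K)) (AlgebraicClosure (v.adicCompletion K))) Subtype.val_injective
    haveI := isDominant_specMap_of_injective h' h'inj
    infer_instance
  haveI : IsSchemeTheoreticallyDominant (specGenericPoint (closureValuationSubring (v.adicCompletion K)) (AlgebraicClosure (v.adicCompletion K)) ≫ Spec.map (CommRingCat.ofHom h')) := IsSchemeTheoreticallyDominant.of_isDominant _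
  -- the refined stage `Spec D′` is connected, reduced, Noetherian (Dedekind); the generic point of the valuation ring `R` is schematically dominant
  haveI : IsNoetherianRing (integralClosure D L') := inferInstance
  haveI : QuasiCompact (specFractionFieldι (closureValuationSubring (v.adicCompletion K)) (toClosureValuationSubring v)).left :=
    inferInstanceAs (QuasiCompact (Spec.map (CommRingCat.ofHom (algebraMap (closureValuationSubring (v.adicCompletion K)) (AlgebraicClosure (v.adicCompletion K))))))
  haveI : IsSchemeTheoreticallyDominant (specFractionFieldι (closureValuationSubring (v.adicCompletion K)) (toClosureValuationSubring v)).left :=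
    Literature.AlgebraicGeometry.Limits.isSchemeTheoreticallyDominant_specMap_of_injective
      (algebraMap (closureValuationSubring (v.adicCompletion K)) (AlgebraicClosure (v.adicCompletion K))) Subtype.val_injective
  -- the `R`-point `x̃` factors through the refined stage: `x̃ = Spec h′ ≫ Spec (D → D′) ≫ z`
  have hxR : (extendPoint (closureValuationSubring (v.adicCompletion K)) (toClosureValuationSubring v) 𝓨.total (𝓨.modelPointsEquiv.symm x)).left = (Spec.map (CommRingCat.ofHom h') ≫ (Spec.map (CommRingCat.ofHom (algebraMap D (integralClosure D L'))))) ≫ z.left := by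
    rw [← hz, ← hh'h, CommRingCat.ofHom_comp, Spec.map_comp]
  have hxR'' : (extendPoint (closureValuationSubring (v.adicCompletion K)) (toClosureValuationSubring v) 𝓨.total (𝓨.modelPointsEquiv.symm x'')).left = (Spec.map (CommRingCat.ofHom h') ≫ (Spec.map (CommRingCat.ofHom (algebraMap D (integralClosure D L'))))) ≫ z''.left := by
    rw [← hz'', ← hh'h, CommRingCat.ofHom_comp, Spec.map_comp]
  -- ALL SIX TRANSFERS AT ONCE (★ (ν8R) `specialFibre_transfers_of_generic_model` at the turnkey's stage and the `R`-model `𝒜_x̃`)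
  have H := specialFibre_transfers_of_generic_model (𝓨.genericIso'.inv.left ≫ pullback.fst 𝓨.total.hom (specGenericPoint (valuationSubringAtPrime K v) K)) z.left z''.left (Spec.map (CommRingCat.ofHom (algebraMap D (integralClosure D L')))) x.left x''.left (specGenericPoint (closureValuationSubring (v.adicCompletion K)) (AlgebraicClosure (v.adicCompletion K)) ≫ Spec.map (CommRingCat.ofHom h)) (specGenericPoint (closureValuationSubring (v.adicCompletion K)) (AlgebraicClosure (v.adicCompletion K)) ≫ Spec.map (CommRingCat.ofHom h')) hpt hpt'' e
    (pullback.fst 𝓨.total.hom (specResidueField v)) (𝓨.geomReductionMap x).left (𝓨.geomReductionMap x'').left (((geomClosedPointIsoSpecResidueField v).inv.left ≫ (specRingHomι (closureValuationSubring (v.adicCompletion K)) (toClosureValuationSubring v) (IsLocalRing.residue (closureValuationSubring (v.adicCompletion K)))).left) ≫ Spec.map (CommRingCat.ofHom h)) (((geomClosedPointIsoSpecResidueField v).inv.left ≫ (specRingHomι (closureValuationSubring (v.adicCompletion K)) (toClosureValuationSubring v) (IsLocalRing.residue (closureValuationSubring (v.adicCompletion K)))).left) ≫ Spec.map (CommRingCat.ofHom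 h')) hspt hspt'' et 𝒜 𝒞 U u hfib
    (Spec.map (CommRingCat.ofHom h')) (extendPoint (closureValuationSubring (v.adicCompletion K)) (toClosureValuationSubring v) 𝓨.total (𝓨.modelPointsEquiv.symm x)).left hxR (specFractionFieldι (closureValuationSubring (v.adicCompletion K)) (toClosureValuationSubring v)).left ((geomClosedPointIsoSpecResidueField v).inv.left ≫ (specRingHomι (closureValuationSubring (v.adicCompletion K)) (toClosureValuationSubring v) (IsLocalRing.residue (closureValuationSubring (v.adicCompletion K)))).left) rfl rfl
    (𝓨.left_specFractionFieldι_comp_extendPoint_modelPointsEquiv_symm x).symm ((𝓨.left_geomReductionMap_comp_fst x).trans (Category.assoc _ _ _).symm)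
  exact ⟨_, H.fst, fun hfin hsurj => H.snd.1 (hisog ⟨hsurj, hfin⟩ _), H.snd.2.1, H.snd.2.2.1, H.snd.2.2.2.1,
    fun 𝒦 incl _ hk => H.snd.2.2.2.2.1 𝒦 incl hk,
    fun 𝒦 incl _ _ hfin hsurj hc W t =>
      H.snd.2.2.2.2.2 (flat_ker_hom L' U (hisog ⟨hsurj, hfin⟩ (specGenericPoint (integralClosure D L') L'))) 𝒦 incl hc t,
    fun 𝒦 incl _ 𝒵 ζ _ hfac =>
      pullback_map_exists_comp_specialFibre_of_generic (𝓨.genericIso'.inv.left ≫ pullback.fst 𝓨.total.hom (specGenericPoint (valuationSubringAtPrime K v) K)) z.left z''.left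
        (Spec.map (CommRingCat.ofHom (algebraMap D (integralClosure D L')))) x.left x''.left
        (specGenericPoint (closureValuationSubring (v.adicCompletion K)) (AlgebraicClosure (v.adicCompletion K)) ≫ Spec.map (CommRingCat.ofHom h))
        (specGenericPoint (closureValuationSubring (v.adicCompletion K)) (AlgebraicClosure (v.adicCompletion K)) ≫ Spec.map (CommRingCat.ofHom h')) hpt hpt'' e
        (pullback.fst 𝓨.total.hom (specResidueField v)) (𝓨.geomReductionMap x).left (𝓨.geomReductionMap x'').left
        (((geomClosedPointIsoSpecResidueField v).inv.left ≫ (specRingHomι (closureValuationSubring (v.adicCompletion K)) (toClosureValuationSubring v) (IsLocalRing.residue (closureValuationSubring (v.adicCompletion K)))).left) ≫ Spec.map (CommRingCat.ofHom h))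
        (((geomClosedPointIsoSpecResidueField v).inv.left ≫ (specRingHomι (closureValuationSubring (v.adicCompletion K)) (toClosureValuationSubring v) (IsLocalRing.residue (closureValuationSubring (v.adicCompletion K)))).left) ≫ Spec.map (CommRingCat.ofHom h'))
        hspt hspt'' et 𝒜 𝒞 U u hfib (Spec.map (CommRingCat.ofHom h')) _ _ hxR hxR''
        (specFractionFieldι (closureValuationSubring (v.adicCompletion K)) (toClosureValuationSubring v)).left
        ((geomClosedPointIsoSpecResidueField v).inv.left ≫ (specRingHomι (closureValuationSubring (v.adicCompletion K)) (toClosureValuationSubring v) (IsLocalRing.residue (closureValuationSubring (v.adicCompletion K)))).left)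
        rfl rfl (𝓨.left_specFractionFieldι_comp_extendPoint_modelPointsEquiv_symm x).symm ((𝓨.left_geomReductionMap_comp_fst x).trans (Category.assoc _ _ _).symm)
        (𝓨.left_specFractionFieldι_comp_extendPoint_modelPointsEquiv_symm x'').symm ((𝓨.left_geomReductionMap_comp_fst x'').trans (Category.assoc _ _ _).symm)
        𝒦 incl 𝒵 ζ hfac⟩

end Head

end AbelianSchemeOver

end Literature.AlgebraicGeometry.AbelianSchemes

end
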